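import Mathlib.Analysis.Analytic.OfScalars
import Mathlib.Analysis.Calculus.LogDerivUniformlyOn
import Mathlib.Analysis.Normed.Module.MultipliableUniformlyOn
import Mathlib.Analysis.SpecialFunctions.Gamma.Digamma
import Literature.Analysis.Complex.HadamardGenusZero
import Literature.NumberTheory.LFunctions.RiemannXiProofs
import Literature.NumberTheory.LFunctions.RiemannXiOrderProofs
import Literature.NumberTheory.LFunctions.XiTaylor
import Literature.NumberTheory.LFunctions.ZetaRealAxis
import Literature.NumberTheory.LFunctions.LevinsonMontgomery
import HarnessLib

/-!
# The partial-fraction expansion of `ζ'/ζ` over the zeros (Levinson–Montgomery (2.1))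

Trunk T-ANT (NumberTheory/LFunctions). Leaf C1 of the decomposition of `Literature.NumberTheory.LFunctions.speiser_iff`.
Levinson–Montgomery, *Zeros of the derivatives of the Riemann zeta-function*, Acta Math. 133
(1974), §2, eq. (2.1) (= Titchmarsh (2.12.7) with the constant `b` absorbed by the pairing of
`ρ` with `1 - ρ`):

  `ζ'/ζ(s) = -1/(s-1) + ½ log π - ½ Γ'/Γ(s/2 + 1) + Σ'_ρ 1/(s-ρ)`,

"with `Σ'` the zeros of `ζ` in the critical strip" summed symmetrically. The classical proof is
Hadamard's factorisation of the entire function `ξ` of order `1` (Titchmarsh (2.12.5)). Here we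
derive it from the tree's NAMED FACT `Literature.Analysis.Complex.hadamard_genus_zero` (Conway XI.3.4 in genus
`0`) applied, as in Titchmarsh §2.12 ("`Ξ(√z)` is also an integral function, and is of order
`½`"), to the entire function `G` with `G(w²) = ξ(½ + w)`:

* `Literature.NumberTheory.LFunctions.xiSq` — `G`, defined as the sum of the power series `Σ γ(n) zⁿ/(8·n!)` (GORZ
  coefficients, `Literature.NumberTheory.LFunctions.hasSum_xiTaylorCoeff`); `xiSq_sq : G(w²) = ξ(½+w)`, `differentiable_xiSq`,
  `norm_xiSq_le` (`‖G z‖ ≤ C exp(‖z‖^{7/8})`, from `riemannXi_order_le_one_holds`), `xiSq_zero_ne`.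
* `Literature.NumberTheory.LFunctions.XiProduct` — the data produced by `hadamard_genus_zero`: `b : ℕ → ℂ`, `Σ‖bₙ‖ < ∞`,
  `∏ (1 - bₙ z) = G(z)/G(0)`; `XiProduct.ofHadamard (hH) : XiProduct`; `XiProduct.conjData` (conjugate data).
* `Literature.NumberTheory.LFunctions.XiProduct.logDeriv_xiSq` — `G'/G(z) = Σₙ -bₙ/(1 - bₙ z)` (`G z ≠ 0`), by Mathlib's
  `logDeriv_tprod_eq_tsum`; `XiProduct.conjData` — the conjugate data `b̄ₙ` is again an `XiProduct`
  (`G` has real Taylor coefficients), whence the SYMMETRISED expansion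
  `XiProduct.logDeriv_riemannXi` : `ξ'/ξ(s) = Σₙ ½ (T(bₙ, s) + T(b̄ₙ, s))`,
  `T(b, s) = -2(s-½) b/(1 - b (s-½)²) = 1/(s-ρ) + 1/(s-(1-ρ))` for `b = (ρ-½)⁻²`
  (`xiTerm_eq_of_sq_eq`); every `bₙ ≠ 0` comes from a nontrivial zero `ρₙ = ½ + bₙ^{-1/2}` of `ζ`
  (`XiProduct.zero_of_ne_zero`, via `riemannXi_eq_zero_iff_holds`).
* `Literature.NumberTheory.LFunctions.XiProduct.logDeriv_riemannZeta` — **(2.1)**: for `ζ(s) ≠ 0`, `s ≠ 1`, `Re s > 0`,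
  `ζ'/ζ(s) = Σₙ ½ (T(bₙ,s) + T(b̄ₙ,s)) - 1/(s-1) + ½ log π - ½ ψ(s/2 + 1)`.

Nothing here is asserted without proof; the only hypothesis is `hadamard_genus_zero`.

## References

* N. Levinson, H. L. Montgomery, Acta Math. 133 (1974), 49–65, §2 eq. (2.1).
* E. C. Titchmarsh, *The Theory of the Riemann Zeta-Function*, 2nd ed. (1986), §2.12,
  eqs. (2.12.5)–(2.12.7).
* J. B. Conway, *Functions of One Complex Variable I*, 2nd ed., GTM 11, Ch. XI Thm. 3.4.
-/

noncomputable section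

open Complex Filter Topology Set
open scoped Nat ComplexConjugate Real

namespace Literature.NumberTheory.LFunctions

/-! ## The entire function `G` with `G(w²) = ξ(½ + w)` -/

/-- The Taylor coefficients of `G`: `aₙ = γ(n)/(8·n!)`, so that `Σ aₙ w^{2n} = ξ(½ + w)`
(GORZ eq. (1) divided by `8`). [folklore] -/
def xiSqCoeff (n : ℕ) : ℂ := (xiTaylorCoeff n : ℂ) / (8 * (n ! : ℂ))

/-- The entire function `G(z) = Σₙ aₙ zⁿ` with `G(w²) = ξ(½ + w)` (Titchmarsh §2.12: "`Ξ(√z)` is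
also an integral function"). [cite: Titchmarsh1986, §2.12] -/
def xiSq : ℂ → ℂ := FormalMultilinearSeries.ofScalarsSum (E := ℂ) xiSqCoeff

/-- `Σ aₙ (w²)ⁿ = ξ(½ + w)`. [folklore] -/
theorem hasSum_xiSqCoeff (w : ℂ) :
    HasSum (fun n : ℕ ↦ xiSqCoeff n * (w ^ 2) ^ n) (riemannXi (1 / 2 + w)) := by
  have h := (hasSum_xiTaylorCoeff riemannXi_conj_holds w).div_const 8
  rw [mul_div_cancel_left₀ _ (by norm_num : (8 : ℂ) ≠ 0)] at h
  refine h.congr_fun fun n ↦ ?_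
  have hn : (n ! : ℂ) ≠ 0 := by exact_mod_cast Nat.factorial_ne_zero n
  rw [xiSqCoeff, ← pow_mul, mul_comm 2 n]
  field_simp

/-- `G(z) = ξ(½ + w)` whenever `w² = z`. [folklore] -/
theorem xiSq_eq_of_sq_eq {z w : ℂ} (h : w ^ 2 = z) : xiSq z = riemannXi (1 / 2 + w) := by
  rw [xiSq, FormalMultilinearSeries.ofScalars_sum_eq]
  simp only [smul_eq_mul]
  rw [← h]
  exact (hasSum_xiSqCoeff w).tsum_eq

/-- `G(w²) = ξ(½ + w)`. [cite: Titchmarsh1986, §2.12] -/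
theorem xiSq_sq (w : ℂ) : xiSq (w ^ 2) = riemannXi (1 / 2 + w) := xiSq_eq_of_sq_eq rfl

/-- `G(z) = ξ(½ + z^{1/2})`. [folklore] -/
theorem xiSq_eq (z : ℂ) : xiSq z = riemannXi (1 / 2 + z ^ (2⁻¹ : ℂ)) :=
  xiSq_eq_of_sq_eq (by exact_mod_cast Complex.cpow_nat_inv_pow z two_ne_zero)

/-- `ξ(s) = G((s - ½)²)`. [folklore] -/
theorem riemannXi_eq_xiSq (s : ℂ) : riemannXi s = xiSq ((s - 1 / 2) ^ 2) := by
  rw [xiSq_sq]; congr 1; ring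

/-- The power series of `G` has infinite radius of convergence. [folklore] -/
theorem xiSq_radius_eq_top :
    (FormalMultilinearSeries.ofScalars ℂ xiSqCoeff).radius = ⊤ := by
  refine ENNReal.eq_top_of_forall_nnreal_le fun r ↦ ?_
  -- the terms `aₙ rⁿ` tend to zero (the series converges at `z = r = (√r)²`), hence are bounded
  have hs : Summable fun n : ℕ ↦ xiSqCoeff n * ((r : ℂ)) ^ n := by
    have := (hasSum_xiSqCoeff ((r : ℂ) ^ (2⁻¹ : ℂ))).summable
    have h2 : (((r : ℝ) : ℂ) ^ (2⁻¹ : ℂ)) ^ 2 = (r : ℂ) := by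
      exact_mod_cast Complex.cpow_nat_inv_pow ((r : ℝ) : ℂ) two_ne_zero
    simpa only [h2] using this
  obtain ⟨C, hC⟩ := (hs.tendsto_atTop_zero.norm).isBoundedUnder_le |>.imp fun C h ↦ h
  simp only [eventually_map, eventually_atTop] at hC
  obtain ⟨M, hM⟩ := hC
  -- bound for all `n`
  set C' : ℝ := max C (Finset.sup' (Finset.range (M + 1)) (by simp)
    fun n ↦ ‖xiSqCoeff n * (r : ℂ) ^ n‖) with hC'
  refine FormalMultilinearSeries.le_radius_of_bound _ C' fun n ↦ ?_
  have hnorm : ‖FormalMultilinearSeries.ofScalars ℂ xiSqCoeff n‖ * (r : ℝ) ^ n =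
      ‖xiSqCoeff n * (r : ℂ) ^ n‖ := by
    rw [FormalMultilinearSeries.ofScalars_norm, norm_mul, norm_pow, Complex.norm_real,
      Real.norm_eq_abs, NNReal.abs_eq]
  rw [hnorm]
  rcases le_or_gt M n with h | h
  · exact (hM n h).trans (le_max_left _ _)
  · refine le_trans ?_ (le_max_right _ _)
    exact Finset.le_sup' (fun n ↦ ‖xiSqCoeff n * (r : ℂ) ^ n‖) (by simp; omega)

/-- `G` is entire. [cite: Titchmarsh1986, §2.12] -/
theorem differentiable_xiSq : Differentiable ℂ xiSq := by
  have h := (FormalMultilinearSeries.ofScalars ℂ xiSqCoeff).hasFPowerSeriesOnBall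
    (by rw [xiSq_radius_eq_top]; exact ENNReal.zero_lt_top)
  rw [xiSq_radius_eq_top] at h
  intro z
  have hz : z ∈ Metric.eball (0 : ℂ) ⊤ := by
    rw [Metric.mem_eball]; exact edist_lt_top z 0
  exact (h.analyticAt_of_mem hz).differentiableAt

/-- `G(0) = ξ(½)`. [folklore] -/
theorem xiSq_zero : xiSq 0 = riemannXi (1 / 2) := by
  simpa using xiSq_sq 0

/-- `ξ(½) ≠ 0` (else `ζ(½) = 0`, but `ζ < 0` on `(0, 1)`), so `G(0) ≠ 0`. [folklore] -/
theorem xiSq_zero_ne : xiSq 0 ≠ 0 := by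
  rw [xiSq_zero]
  intro h
  obtain ⟨-, -, hz⟩ := riemannZeta_eq_zero_of_riemannXi_eq_zero h
  have := riemannZeta_ofReal_ne_zero_of_pos_of_lt_one (1 / 2) (by norm_num) (by norm_num)
  push_cast at this
  exact this hz

/-- Schwarz reflection for `G`: `G(z̄) = conj G(z)` (its Taylor coefficients are real).
[cite: Titchmarsh1986, §2.1] -/
theorem xiSq_conj (z : ℂ) : xiSq (conj z) = conj (xiSq z) := by
  set w : ℂ := z ^ (2⁻¹ : ℂ)
  have hw : w ^ 2 = z := by exact_mod_cast Complex.cpow_nat_inv_pow z two_ne_zero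
  have hw' : (conj w) ^ 2 = conj z := by rw [← map_pow, hw]
  rw [xiSq_eq_of_sq_eq hw, xiSq_eq_of_sq_eq hw', ← riemannXi_conj_holds]
  congr 1
  simp only [map_add, map_div₀, map_one, map_ofNat]

/-- `G(0)` is real: `conj G(0) = G(0)`. [folklore] -/
theorem conj_xiSq_zero : conj (xiSq 0) = xiSq 0 := by
  rw [← xiSq_conj, map_zero]

/-! ### Growth: `G` has order `≤ 7/8 < 1` -/

/-- Elementary: for `A, u ≥ 0`, `A u log(1+u) ≤ 4A (1+u)^{5/4}`. [folklore] -/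
lemma mul_log_le_rpow {A u : ℝ} (hA : 0 ≤ A) (hu : 0 ≤ u) :
    A * u * Real.log (1 + u) ≤ 4 * A * (1 + u) ^ (5 / 4 : ℝ) := by
  have h1 : Real.log (1 + u) ≤ (1 + u) ^ (1 / 4 : ℝ) / (1 / 4) :=
    Real.log_le_rpow_div (by linarith) (by norm_num)
  have h2 : u ≤ (1 + u) ^ (1 : ℝ) := by rw [Real.rpow_one]; linarith
  calc A * u * Real.log (1 + u) ≤ A * (1 + u) ^ (1 : ℝ) * ((1 + u) ^ (1 / 4 : ℝ) / (1 / 4)) := by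
        gcongr
        exact Real.log_nonneg (by linarith)
    _ = 4 * A * ((1 + u) ^ (1 : ℝ) * (1 + u) ^ (1 / 4 : ℝ)) := by ring
    _ = 4 * A * (1 + u) ^ (5 / 4 : ℝ) := by
        rw [← Real.rpow_add (by linarith)]; norm_num

/-- Elementary: `(3/2 + x)^{5/4} ≤ 2^{5/4} ((3/2)^{5/4} + x^{5/4})` for `x ≥ 0`. [folklore] -/
lemma rpow_add_le {x : ℝ} (hx : 0 ≤ x) :
    (3 / 2 + x) ^ (5 / 4 : ℝ) ≤ 2 ^ (5 / 4 : ℝ) * ((3 / 2 : ℝ) ^ (5 / 4 : ℝ) + x ^ (5 / 4 : ℝ)) := by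
  have hm : 3 / 2 + x ≤ 2 * max (3 / 2) x := by
    rcases le_total (3 / 2 : ℝ) x with h | h
    · rw [max_eq_right h]; linarith
    · rw [max_eq_left h]; linarith
  have hmax : (max (3 / 2 : ℝ) x) ^ (5 / 4 : ℝ) ≤ (3 / 2 : ℝ) ^ (5 / 4 : ℝ) + x ^ (5 / 4 : ℝ) := by
    rcases le_total (3 / 2 : ℝ) x with h | h
    · rw [max_eq_right h]
      linarith [Real.rpow_nonneg (by norm_num : (0 : ℝ) ≤ 3 / 2) (5 / 4 : ℝ)]
    · rw [max_eq_left h]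
      linarith [Real.rpow_nonneg hx (5 / 4 : ℝ)]
  calc (3 / 2 + x) ^ (5 / 4 : ℝ) ≤ (2 * max (3 / 2) x) ^ (5 / 4 : ℝ) :=
        Real.rpow_le_rpow (by linarith) hm (by norm_num)
    _ = 2 ^ (5 / 4 : ℝ) * (max (3 / 2) x) ^ (5 / 4 : ℝ) :=
        Real.mul_rpow (by norm_num) (le_max_of_le_left (by norm_num))
    _ ≤ 2 ^ (5 / 4 : ℝ) * ((3 / 2 : ℝ) ^ (5 / 4 : ℝ) + x ^ (5 / 4 : ℝ)) := by
        gcongr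

/-- Elementary: `K x^{5/8} ≤ x^{7/8} + K^{7/2}` for `K, x ≥ 0`. [folklore] -/
lemma mul_rpow_le_rpow_add {K x : ℝ} (hK : 0 ≤ K) (hx : 0 ≤ x) :
    K * x ^ (5 / 8 : ℝ) ≤ x ^ (7 / 8 : ℝ) + K ^ (7 / 2 : ℝ) := by
  have h58 : 0 ≤ x ^ (5 / 8 : ℝ) := Real.rpow_nonneg hx _
  rcases le_or_gt K (x ^ (1 / 4 : ℝ)) with h | h
  · calc K * x ^ (5 / 8 : ℝ) ≤ x ^ (1 / 4 : ℝ) * x ^ (5 / 8 : ℝ) := by gcongr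
      _ = x ^ (7 / 8 : ℝ) := by rw [← Real.rpow_add' hx (by norm_num)]; norm_num
      _ ≤ x ^ (7 / 8 : ℝ) + K ^ (7 / 2 : ℝ) := le_add_of_nonneg_right (Real.rpow_nonneg hK _)
  · have hx' : x ^ (5 / 8 : ℝ) ≤ K ^ (5 / 2 : ℝ) := by
      have : x ^ (5 / 8 : ℝ) = (x ^ (1 / 4 : ℝ)) ^ (5 / 2 : ℝ) := by
        rw [← Real.rpow_mul hx]; norm_num
      rw [this]
      exact Real.rpow_le_rpow (Real.rpow_nonneg hx _) h.le (by norm_num)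
    calc K * x ^ (5 / 8 : ℝ) ≤ K * K ^ (5 / 2 : ℝ) := by gcongr
      _ = K ^ (7 / 2 : ℝ) := by
          rw [show (7 / 2 : ℝ) = 1 + 5 / 2 by norm_num, Real.rpow_add' hK (by norm_num),
            Real.rpow_one]
      _ ≤ x ^ (7 / 8 : ℝ) + K ^ (7 / 2 : ℝ) := le_add_of_nonneg_left (Real.rpow_nonneg hx _)

/-- **`G` has order at most `7/8`**: `‖G(z)‖ ≤ C exp(‖z‖^{7/8})` for all `z` (Titchmarsh §2.12:
`Ξ(√z)` "is of order `½`"; any exponent in `(½, 1)` suffices for Hadamard in genus `0`).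
[cite: Titchmarsh1986, §2.12] -/
theorem norm_xiSq_le : ∃ C : ℝ, ∀ z : ℂ, ‖xiSq z‖ ≤ C * Real.exp (‖z‖ ^ (7 / 8 : ℝ)) := by
  obtain ⟨A, C, hA, hC, hξ⟩ := riemannXi_order_le_one_holds.nonneg
  set K₀ : ℝ := 4 * A * (2 ^ (5 / 4 : ℝ) * (3 / 2 : ℝ) ^ (5 / 4 : ℝ)) with hK₀
  set K₂ : ℝ := 4 * A * 2 ^ (5 / 4 : ℝ) with hK₂
  have hK₂0 : 0 ≤ K₂ := by positivity
  refine ⟨C * Real.exp (K₀ + K₂ ^ (7 / 2 : ℝ)), fun z ↦ ?_⟩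
  set w : ℂ := z ^ (((2 : ℝ)⁻¹ : ℝ) : ℂ) with hw
  have hw2 : w ^ 2 = z := by
    rw [hw]; push_cast; exact_mod_cast Complex.cpow_nat_inv_pow z two_ne_zero
  have hnw : ‖w‖ = ‖z‖ ^ (1 / 2 : ℝ) := by rw [hw, Complex.norm_cpow_real]; norm_num
  rw [xiSq_eq_of_sq_eq hw2]
  refine (hξ _).trans ?_
  set r : ℝ := ‖z‖ with hr
  have hr0 : 0 ≤ r := norm_nonneg _
  set u : ℝ := 1 / 2 + r ^ (1 / 2 : ℝ) with hu
  have hu0 : 0 ≤ u := by positivity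
  have hs : ‖(1 / 2 : ℂ) + w‖ ≤ u := by
    refine (norm_add_le _ _).trans ?_
    rw [hnw, hu]
    norm_num
  -- the exponent
  have hE : A * ‖(1 / 2 : ℂ) + w‖ * Real.log (1 + ‖(1 / 2 : ℂ) + w‖) ≤ r ^ (7 / 8 : ℝ) + (K₀ + K₂ ^ (7 / 2 : ℝ)) := by
    have h1 : A * ‖(1 / 2 : ℂ) + w‖ * Real.log (1 + ‖(1 / 2 : ℂ) + w‖) ≤ A * u * Real.log (1 + u) := by
      have hn0 := norm_nonneg ((1 / 2 : ℂ) + w)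
      have hlog0 : 0 ≤ Real.log (1 + ‖(1 / 2 : ℂ) + w‖) := Real.log_nonneg (by linarith)
      have hlogle : Real.log (1 + ‖(1 / 2 : ℂ) + w‖) ≤ Real.log (1 + u) :=
        Real.log_le_log (by linarith) (by linarith)
      calc A * ‖(1 / 2 : ℂ) + w‖ * Real.log (1 + ‖(1 / 2 : ℂ) + w‖)
          ≤ A * u * Real.log (1 + ‖(1 / 2 : ℂ) + w‖) := by gcongr
        _ ≤ A * u * Real.log (1 + u) := by gcongr
    have h2 := mul_log_le_rpow hA hu0
    have h3 : (1 + u) ^ (5 / 4 : ℝ) ≤ 2 ^ (5 / 4 : ℝ) * ((3 / 2 : ℝ) ^ (5 / 4 : ℝ) + r ^ (5 / 8 : ℝ)) := by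
      have := rpow_add_le (Real.rpow_nonneg hr0 (1 / 2 : ℝ))
      rw [← Real.rpow_mul hr0] at this
      rw [hu, show 1 + (1 / 2 + r ^ (1 / 2 : ℝ)) = 3 / 2 + r ^ (1 / 2 : ℝ) by ring]
      convert this using 4
      norm_num
    have h4 := mul_rpow_le_rpow_add hK₂0 hr0
    calc A * ‖(1 / 2 : ℂ) + w‖ * Real.log (1 + ‖(1 / 2 : ℂ) + w‖) ≤ 4 * A * (1 + u) ^ (5 / 4 : ℝ) :=
          h1.trans h2
      _ ≤ 4 * A * (2 ^ (5 / 4 : ℝ) * ((3 / 2 : ℝ) ^ (5 / 4 : ℝ) + r ^ (5 / 8 : ℝ))) := by gcongr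
      _ = K₀ + K₂ * r ^ (5 / 8 : ℝ) := by rw [hK₀, hK₂]; ring
      _ ≤ r ^ (7 / 8 : ℝ) + (K₀ + K₂ ^ (7 / 2 : ℝ)) := by linarith
  calc C * Real.exp (A * ‖(1 / 2 : ℂ) + w‖ * Real.log (1 + ‖(1 / 2 : ℂ) + w‖))
      ≤ C * Real.exp (r ^ (7 / 8 : ℝ) + (K₀ + K₂ ^ (7 / 2 : ℝ))) := by gcongr
    _ = C * Real.exp (K₀ + K₂ ^ (7 / 2 : ℝ)) * Real.exp (r ^ (7 / 8 : ℝ)) := by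
        rw [Real.exp_add]; ring

/-! ## The Hadamard product data -/

/-- The output of Hadamard's theorem in genus zero for `G`: a sequence `bₙ` (the inverses of the
zeros of `G`, with multiplicity, padded with zeros) with `Σ ‖bₙ‖ < ∞` and
`∏ₙ (1 - bₙ z) = G(z)/G(0)`. [cite: Conway1978, Ch. XI Thm. 3.4] -/
structure XiProduct where
  /-- the inverse zeros -/
  b : ℕ → ℂ
  /-- `Σ ‖bₙ‖ < ∞` -/
  summable_norm : Summable fun n ↦ ‖b n‖
  /-- `∏ₙ (1 - bₙ z) = G(z)/G(0)` -/
  hasProd : ∀ z : ℂ, HasProd (fun n ↦ 1 - b n * z) (xiSq z / xiSq 0)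

/-- **Hadamard's theorem (genus `0`) applied to `G`.** [cite: Conway1978, Ch. XI Thm. 3.4] -/
theorem exists_xiProduct (hH : Literature.Analysis.Complex.hadamard_genus_zero) : Nonempty XiProduct := by
  obtain ⟨C, hC⟩ := norm_xiSq_le
  obtain ⟨b, hb, hprod⟩ := hH xiSq (7 / 8) C differentiable_xiSq (by norm_num) hC xiSq_zero_ne
  exact ⟨⟨b, hb, hprod⟩⟩

/-- A choice of Hadamard data for `G`. [cite: Conway1978, Ch. XI Thm. 3.4] -/
def XiProduct.ofHadamard (hH : Literature.Analysis.Complex.hadamard_genus_zero) : XiProduct :=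
  Classical.choice (exists_xiProduct hH)

namespace XiProduct

variable (P : XiProduct)

/-- The conjugate data `b̄ₙ` is again Hadamard data for `G` (`G(z̄) = conj G(z)`, `G(0) ∈ ℝ`).
[folklore] -/
def conjData : XiProduct where
  b n := starRingEnd ℂ (P.b n)
  summable_norm := by simpa using P.summable_norm
  hasProd z := by
    have h := (P.hasProd (starRingEnd ℂ z)).map (starRingEnd ℂ) continuous_conj
    have hval : starRingEnd ℂ (xiSq (starRingEnd ℂ z) / xiSq 0) = xiSq z / xiSq 0 := by
      rw [map_div₀, xiSq_conj, Complex.conj_conj, conj_xiSq_zero]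
    rw [hval] at h
    refine h.congr_fun fun n ↦ ?_
    simp only [Function.comp_apply, map_sub, map_one, map_mul, Complex.conj_conj]

/-- `(P.conjData).b n = conj (P.b n)`. [folklore] -/
@[simp] lemma conjData_b (n : ℕ) : P.conjData.b n = starRingEnd ℂ (P.b n) := rfl

/-- An infinite product with a vanishing factor is zero. [folklore] -/
lemma _root_.Literature.NumberTheory.LFunctions.hasProd_zero_of_eq_zero {f : ℕ → ℂ} {a : ℂ} (h : HasProd f a) {n : ℕ}
    (hn : f n = 0) : a = 0 := by
  have h0 : Tendsto (fun s : Finset ℕ ↦ ∏ i ∈ s, f i) atTop (𝓝 0) := by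
    refine tendsto_const_nhds.congr' ?_
    filter_upwards [eventually_ge_atTop {n}] with s hs
    exact (Finset.prod_eq_zero (hs (Finset.mem_singleton_self n)) hn).symm
  exact tendsto_nhds_unique h h0

/-- If `bₙ ≠ 0` then `1/bₙ` is a zero of `G`. [folklore] -/
theorem xiSq_inv_eq_zero {n : ℕ} (hn : P.b n ≠ 0) : xiSq (P.b n)⁻¹ = 0 := by
  have h := hasProd_zero_of_eq_zero (P.hasProd (P.b n)⁻¹) (n := n) (by field_simp; ring)
  rcases div_eq_zero_iff.1 h with h | h
  · exact h
  · exact absurd h xiSq_zero_ne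

/-- The zero of `ζ` attached to `bₙ ≠ 0`: `ρₙ = ½ + bₙ^{-1/2}`. [folklore] -/
def zero (n : ℕ) : ℂ := 1 / 2 + ((P.b n)⁻¹) ^ (2⁻¹ : ℂ)

/-- `(ρₙ - ½)² = 1/bₙ`. [folklore] -/
theorem zero_sub_half_sq (n : ℕ) : (P.zero n - 1 / 2) ^ 2 = (P.b n)⁻¹ := by
  rw [zero, add_sub_cancel_left]
  exact_mod_cast Complex.cpow_nat_inv_pow _ two_ne_zero

/-- **Each `bₙ ≠ 0` comes from a nontrivial zero of `ζ`**: `ζ(ρₙ) = 0` and `0 < Re ρₙ < 1`.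
[cite: Titchmarsh1986, §2.12] -/
theorem zero_spec {n : ℕ} (hn : P.b n ≠ 0) :
    riemannZeta (P.zero n) = 0 ∧ 0 < (P.zero n).re ∧ (P.zero n).re < 1 := by
  have hξ : riemannXi (P.zero n) = 0 := by
    rw [riemannXi_eq_xiSq, zero_sub_half_sq]
    exact P.xiSq_inv_eq_zero hn
  exact (riemannXi_eq_zero_iff_holds _).1 hξ

/-- All factors `1 - bₙ x` are non-zero when `G(x) ≠ 0`. [folklore] -/
theorem factor_ne_zero {x : ℂ} (hx : xiSq x ≠ 0) (n : ℕ) : 1 - P.b n * x ≠ 0 := by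
  intro h
  have := hasProd_zero_of_eq_zero (P.hasProd x) h
  rcases div_eq_zero_iff.1 this with h' | h'
  · exact hx h'
  · exact xiSq_zero_ne h'

/-- The log-derivative terms `-bₙ/(1 - bₙ x)` are absolutely summable. [folklore] -/
theorem summable_logDeriv_factor (x : ℂ) :
    Summable fun n ↦ ‖-P.b n / (1 - P.b n * x)‖ := by
  -- eventually `‖bₙ x‖ ≤ 1/2`, so `‖1 - bₙ x‖ ≥ 1/2`
  have hb0 : Tendsto (fun n ↦ P.b n) atTop (𝓝 0) := by
    have := P.summable_norm.tendsto_atTop_zero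
    exact tendsto_zero_iff_norm_tendsto_zero.2 this
  have hev : ∀ᶠ n in atTop, ‖P.b n * x‖ ≤ 1 / 2 := by
    have : Tendsto (fun n ↦ P.b n * x) atTop (𝓝 0) := by simpa using hb0.mul_const x
    have := (tendsto_zero_iff_norm_tendsto_zero.1 this)
    exact (this.eventually (ge_mem_nhds (by norm_num : (0 : ℝ) < 1 / 2)))
  refine Summable.of_norm_bounded_eventually (g := fun n ↦ 2 * ‖P.b n‖)
    (P.summable_norm.mul_left 2) ?_
  rw [Nat.cofinite_eq_atTop]
  filter_upwards [hev] with n hn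
  rw [norm_norm, norm_div, norm_neg]
  have h1 : 1 / 2 ≤ ‖1 - P.b n * x‖ := by
    have := norm_sub_norm_le (1 : ℂ) (P.b n * x)
    rw [norm_one] at this
    linarith
  rw [div_le_iff₀ (by linarith)]
  nlinarith [norm_nonneg (P.b n)]

/-- **Logarithmic derivative of the Hadamard product**: for `G(x) ≠ 0`,
`G'(x)/G(x) = Σₙ -bₙ/(1 - bₙ x)` (Mathlib's `logDeriv_tprod_eq_tsum` on the disc `|z| < |x| + 1`,
where `∏ (1 - bₙ z)` converges locally uniformly). [cite: Conway1978, Ch. XI Thm. 3.4] -/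
theorem logDeriv_xiSq {x : ℂ} (hx : xiSq x ≠ 0) :
    logDeriv xiSq x = ∑' n, -P.b n / (1 - P.b n * x) := by
  set K : Set ℂ := Metric.ball 0 (‖x‖ + 1) with hK
  have hKo : IsOpen K := Metric.isOpen_ball
  have hxK : x ∈ K := by simp [hK]
  set f : ℕ → ℂ → ℂ := fun n z ↦ -(P.b n * z) with hf
  -- rewrite the product in the `1 + f n z` form
  have hprod_fun : (fun z ↦ ∏' n, (1 + f n z)) = fun z ↦ (xiSq 0)⁻¹ * xiSq z := by
    funext z
    have := (P.hasProd z).tprod_eq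
    simp only [hf, ← sub_eq_add_neg]
    rw [this]; field_simp
  have hmult : MultipliableLocallyUniformlyOn (fun n z ↦ 1 + f n z) K := by
    refine Summable.multipliableLocallyUniformlyOn_nat_one_add hKo (u := fun n ↦ ‖P.b n‖ * (‖x‖ + 1))
      (P.summable_norm.mul_right _) (Eventually.of_forall fun n z hz ↦ ?_) fun n ↦ by fun_prop
    simp only [hf, norm_neg, norm_mul]
    have : ‖z‖ ≤ ‖x‖ + 1 := by
      simp only [hK, Metric.mem_ball, dist_zero_right] at hz; exact hz.le
    gcongr
  have hlog : ∀ n, logDeriv (fun z ↦ 1 + f n z) x = -P.b n / (1 - P.b n * x) := by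
    intro n
    rw [logDeriv_apply]
    have hd : HasDerivAt (fun z ↦ 1 + f n z) (-(P.b n * 1)) x := by
      simpa [hf] using ((hasDerivAt_id x).const_mul (P.b n)).neg.const_add 1
    rw [hd.deriv]
    simp only [hf, mul_one]
    ring
  have h := logDeriv_tprod_eq_tsum hKo hxK (f := fun n z ↦ 1 + f n z)
    (fun n ↦ by simpa [hf, sub_eq_add_neg] using P.factor_ne_zero hx n)
    (fun n ↦ by fun_prop)
    (by simpa only [hlog] using (P.summable_logDeriv_factor x).of_norm)
    hmult
    (by
      have := congrFun hprod_fun x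
      rw [this]
      exact mul_ne_zero (inv_ne_zero xiSq_zero_ne) hx)
  simp only [hlog] at h
  rw [hprod_fun, logDeriv_const_mul x _ (inv_ne_zero xiSq_zero_ne)] at h
  exact h

end XiProduct

/-! ## The expansion of `ξ'/ξ` and of `ζ'/ζ` -/

/-- The term of the expansion of `ξ'/ξ` attached to an inverse zero `b` of `G`:
`T(b, s) = -2(s-½) b/(1 - b (s-½)²)`. [folklore] -/
def xiTerm (b s : ℂ) : ℂ := -(2 * (s - 1 / 2) * b) / (1 - b * (s - 1 / 2) ^ 2)

/-- For `b = (ρ - ½)⁻²`: `T(b, s) = 1/(s - ρ) + 1/(s - (1 - ρ))` (away from the two poles). [folklore] -/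
theorem xiTerm_eq_of_sq_eq {b ρ s : ℂ} (hb : b ≠ 0) (hρ : (ρ - 1 / 2) ^ 2 = b⁻¹) (h₁ : s ≠ ρ)
    (h₂ : s ≠ 1 - ρ) : xiTerm b s = 1 / (s - ρ) + 1 / (s - (1 - ρ)) := by
  set c : ℂ := ρ - 1 / 2 with hc
  set w : ℂ := s - 1 / 2 with hw
  have hc0 : c ≠ 0 := by
    intro h; rw [h] at hρ; simp at hρ; exact hb hρ.symm
  have hb' : b = (c ^ 2)⁻¹ := by rw [hρ, inv_inv]
  have h₁' : w - c ≠ 0 := by rw [hw, hc]; intro h; apply h₁; linear_combination h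
  have h₂' : w + c ≠ 0 := by rw [hw, hc]; intro h; apply h₂; linear_combination h
  have hL : xiTerm b s = 2 * w / (w ^ 2 - c ^ 2) := by
    rw [xiTerm, hb', ← hw]
    have : w ^ 2 - c ^ 2 ≠ 0 := by
      rw [show w ^ 2 - c ^ 2 = (w - c) * (w + c) by ring]; exact mul_ne_zero h₁' h₂'
    have hc2 : c ^ 2 ≠ 0 := pow_ne_zero 2 hc0
    rw [div_eq_div_iff ?_ this]
    · field_simp
      ring
    · intro h
      apply this
      have : (c ^ 2)⁻¹ * w ^ 2 = 1 := by linear_combination -h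
      have : w ^ 2 = c ^ 2 := by field_simp at this; linear_combination this
      rw [this]; ring
  have hR : 1 / (s - ρ) + 1 / (s - (1 - ρ)) = 2 * w / (w ^ 2 - c ^ 2) := by
    have e1 : s - ρ = w - c := by rw [hw, hc]; ring
    have e2 : s - (1 - ρ) = w + c := by rw [hw, hc]; ring
    rw [e1, e2, show w ^ 2 - c ^ 2 = (w - c) * (w + c) by ring]
    field_simp
    ring
  rw [hL, hR]

namespace XiProduct

variable (P : XiProduct)

/-- **`ξ'/ξ(s) = Σₙ T(bₙ, s)`** for `ξ(s) ≠ 0` (chain rule `ξ(s) = G((s-½)²)`), with absolute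
convergence. [cite: Titchmarsh1986, §2.12 eq. (2.12.7)] -/
theorem logDeriv_riemannXi {s : ℂ} (hs : riemannXi s ≠ 0) :
    logDeriv riemannXi s = ∑' n, xiTerm (P.b n) s ∧ Summable fun n ↦ ‖xiTerm (P.b n) s‖ := by
  set x : ℂ := (s - 1 / 2) ^ 2 with hx
  have hx0 : xiSq x ≠ 0 := by rwa [hx, ← riemannXi_eq_xiSq]
  have hfun : riemannXi = xiSq ∘ fun z ↦ (z - 1 / 2) ^ 2 := funext fun z ↦ riemannXi_eq_xiSq z
  have hg : HasDerivAt (fun z : ℂ ↦ (z - 1 / 2) ^ 2) (2 * (s - 1 / 2)) s := by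
    have := ((hasDerivAt_id' s).sub_const (1 / 2 : ℂ)).fun_pow 2
    refine this.congr_deriv ?_
    push_cast; ring
  have hterm : ∀ n, -P.b n / (1 - P.b n * x) * (2 * (s - 1 / 2)) = xiTerm (P.b n) s := by
    intro n; rw [xiTerm, hx]; ring
  constructor
  · rw [hfun, logDeriv_comp (differentiable_xiSq _) hg.differentiableAt, hg.deriv]
    rw [P.logDeriv_xiSq hx0, ← tsum_mul_right]
    exact tsum_congr fun n ↦ hterm n
  · have := (P.summable_logDeriv_factor x).mul_right ‖2 * (s - 1 / 2)‖
    refine this.congr fun n ↦ ?_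
    rw [← norm_mul, hterm]

/-- **Symmetrised expansion**: `ξ'/ξ(s) = Σₙ ½ (T(bₙ, s) + T(b̄ₙ, s))` (average of the expansions
for the Hadamard data `bₙ` and `b̄ₙ`). Each index thus contributes the quadruple
`{ρ, 1-ρ, ρ̄, 1-ρ̄}` with weight `½`, which makes the pairing manipulations of Levinson–Montgomery
(2.2)–(2.3) available without any bookkeeping of multiplicities. [cite: LevinsonMontgomery1974, §2 eq. (2.1)–(2.3)] -/
theorem logDeriv_riemannXi_symm {s : ℂ} (hs : riemannXi s ≠ 0) :
    logDeriv riemannXi s = ∑' n, (xiTerm (P.b n) s + xiTerm (starRingEnd ℂ (P.b n)) s) / 2 ∧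
      Summable fun n ↦ (xiTerm (P.b n) s + xiTerm (starRingEnd ℂ (P.b n)) s) / 2 := by
  obtain ⟨h1, hs1⟩ := P.logDeriv_riemannXi hs
  obtain ⟨h2, hs2⟩ := P.conjData.logDeriv_riemannXi hs
  simp only [conjData_b] at h2 hs2
  have hsum : Summable fun n ↦ (xiTerm (P.b n) s + xiTerm (starRingEnd ℂ (P.b n)) s) / 2 :=
    (hs1.of_norm.add hs2.of_norm).div_const 2
  refine ⟨?_, hsum⟩
  rw [tsum_div_const, hs1.of_norm.tsum_add hs2.of_norm, ← h1, ← h2]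
  ring

/-- `logDeriv` only depends on the germ of the function. [folklore] -/
lemma _root_.Literature.NumberTheory.LFunctions.logDeriv_congr_of_eventuallyEq {f g : ℂ → ℂ} {s : ℂ} (h : f =ᶠ[𝓝 s] g) :
    logDeriv f s = logDeriv g s := by
  rw [logDeriv_apply, logDeriv_apply, h.deriv_eq, h.eq_of_nhds]

/-- `logDeriv Γℝ(s) = -½ log π + ½ ψ(s/2)` off the poles. [folklore] -/
lemma _root_.Literature.NumberTheory.LFunctions.logDeriv_Gammaℝ {s : ℂ} (hs : ∀ m : ℕ, s / 2 ≠ -m) :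
    logDeriv Gammaℝ s = -(Complex.log π) / 2 + Complex.digamma (s / 2) / 2 := by
  have hΓ : Gammaℝ s ≠ 0 := by
    rw [Ne, Gammaℝ_eq_zero_iff]
    rintro ⟨n, hn⟩
    exact hs n (by rw [hn]; ring)
  rw [logDeriv_apply, (RealZeros.hasDerivAt_Gammaℝ hs).deriv]
  field_simp

/-- **Levinson–Montgomery (2.1) / Titchmarsh (2.12.7)**: for `ζ(s) ≠ 0`, `s ≠ 1`, `Re s > 0`,
`ζ'/ζ(s) = Σₙ ½(T(bₙ,s) + T(b̄ₙ,s)) - 1/(s-1) + ½ log π - ½ ψ(s/2 + 1)`.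
[cite: LevinsonMontgomery1974, §2 eq. (2.1)] -/
theorem logDeriv_riemannZeta {s : ℂ} (hζ : riemannZeta s ≠ 0) (hs1 : s ≠ 1) (hs : 0 < s.re) :
    logDeriv riemannZeta s =
      ∑' n, (xiTerm (P.b n) s + xiTerm (starRingEnd ℂ (P.b n)) s) / 2 -
        1 / (s - 1) + (Real.log Real.pi : ℂ) / 2 - Complex.digamma (s / 2 + 1) / 2 := by
  have hs0 : s ≠ 0 := fun h ↦ by rw [h] at hs; simp at hs
  have hΓ : Gammaℝ s ≠ 0 := Gammaℝ_ne_zero_of_re_pos hs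
  have hξ : riemannXi s ≠ 0 := fun h ↦ hζ (riemannZeta_eq_zero_of_riemannXi_eq_zero h).2.2
  have hpole : ∀ m : ℕ, s / 2 ≠ -m := by
    intro m h
    have := congrArg Complex.re h
    simp at this
    linarith
  -- `ξ = F · ζ` near `s`, with `F(z) = ½ z (z-1) Γℝ(z)`
  set F : ℂ → ℂ := fun z ↦ z * (z - 1) / 2 * Gammaℝ z with hF
  have hev : riemannXi =ᶠ[𝓝 s] fun z ↦ F z * riemannZeta z := by
    have ho : IsOpen {z : ℂ | 0 < z.re ∧ z ≠ 1} :=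
      (isOpen_lt continuous_const continuous_re).inter isOpen_ne
    filter_upwards [ho.mem_nhds ⟨hs, hs1⟩] with z hz
    have hz0 : z ≠ 0 := fun h ↦ by rw [h] at hz; simp at hz
    have hΓz : Gammaℝ z ≠ 0 := Gammaℝ_ne_zero_of_re_pos hz.1
    rw [riemannXi_eq_mul_completedRiemannZeta hz0 hz.2, riemannZeta_def_of_ne_zero hz0, hF]
    field_simp
  have hFs : F s ≠ 0 := by
    have : F s = s * (s - 1) / 2 * Gammaℝ s := rfl
    rw [this]
    exact mul_ne_zero (div_ne_zero (mul_ne_zero hs0 (sub_ne_zero.2 hs1)) two_ne_zero) hΓ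
  have hdΓ : DifferentiableAt ℂ Gammaℝ s := (RealZeros.hasDerivAt_Gammaℝ hpole).differentiableAt
  have hdF : DifferentiableAt ℂ F s := by simp only [hF]; fun_prop
  have hdζ : DifferentiableAt ℂ riemannZeta s := differentiableAt_riemannZeta hs1
  -- log-derivative of `F`
  have hpoly : logDeriv (fun z : ℂ ↦ z * (z - 1) / 2) s = 1 / s + 1 / (s - 1) := by
    rw [logDeriv_apply]
    have hd : HasDerivAt (fun z : ℂ ↦ z * (z - 1) / 2) ((1 * (s - 1) + s * 1) / 2) s :=
      ((hasDerivAt_id' s).fun_mul ((hasDerivAt_id' s).sub_const 1)).div_const 2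
    rw [hd.deriv]
    have hs1' : s - 1 ≠ 0 := sub_ne_zero.2 hs1
    field_simp
  have hlogF : logDeriv F s = 1 / s + 1 / (s - 1) + (-(Complex.log π) / 2 + Complex.digamma (s / 2) / 2) := by
    simp only [hF]
    rw [logDeriv_mul (f := fun z : ℂ ↦ z * (z - 1) / 2) (g := Gammaℝ) s
      (div_ne_zero (mul_ne_zero hs0 (sub_ne_zero.2 hs1)) two_ne_zero) hΓ
      (by fun_prop) hdΓ, hpoly, logDeriv_Gammaℝ hpole]
  -- assemble
  have hmain : logDeriv riemannXi s = logDeriv F s + logDeriv riemannZeta s := by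
    rw [logDeriv_congr_of_eventuallyEq hev, logDeriv_mul (f := F) (g := riemannZeta) s hFs hζ hdF hdζ]
  have hψ : Complex.digamma (s / 2 + 1) = Complex.digamma (s / 2) + (s / 2)⁻¹ :=
    Complex.digamma_apply_add_one (s / 2) hpole
  have hlogpi : Complex.log π = ((Real.log Real.pi : ℝ) : ℂ) := (Complex.ofReal_log Real.pi_pos.le).symm
  obtain ⟨hsym, -⟩ := P.logDeriv_riemannXi_symm hξ
  rw [hlogF, hsym] at hmain
  rw [hψ]
  rw [hlogpi] at hmain
  have hs2 : s / 2 ≠ 0 := div_ne_zero hs0 two_ne_zero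
  linear_combination (norm := skip) -hmain
  field_simp
  ring

end XiProduct

/-! ## Real parts: Levinson–Montgomery's pair terms (2.2) -/

/-- Levinson–Montgomery's pair term (2.2): for a zero `β + iγ` (`β < ½`) paired with `1 - β + iγ`,
at `s = σ + it`, `u = t - γ`:
`Re(1/(s-ρ) + 1/(s-1+ρ̄)) = (σ-β)/((σ-β)² + u²) + (σ-1+β)/((σ-1+β)² + u²)`.
[cite: LevinsonMontgomery1974, §2 eq. (2.2)] -/
def lmPair (σ β u : ℝ) : ℝ :=
  (σ - β) / ((σ - β) ^ 2 + u ^ 2) + (σ - 1 + β) / ((σ - 1 + β) ^ 2 + u ^ 2)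

/-- `Re (1/(s - a)) = (σ - Re a)/((σ - Re a)² + (t - Im a)²)`. [folklore] -/
lemma re_one_div_sub (s a : ℂ) :
    (1 / (s - a)).re = (s.re - a.re) / ((s.re - a.re) ^ 2 + (s.im - a.im) ^ 2) := by
  rw [one_div, Complex.inv_re, Complex.normSq_apply]
  simp only [sub_re, sub_im]
  ring_nf

/-- **Real part of a symmetrised term = the two Levinson–Montgomery pair terms** at heights
`γ` and `-γ`, each with weight `½`: for `b = (ρ-½)⁻²`, `ρ = β + iγ`, `s = σ + it` off the four
points `ρ, 1-ρ, ρ̄, 1-ρ̄`,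
`Re ½(T(b,s) + T(b̄,s)) = ½ (lmPair σ β (t-γ) + lmPair σ β (t+γ))`.
[cite: LevinsonMontgomery1974, §2 eq. (2.2)] -/
theorem re_xiTerm_add_conj {b ρ s : ℂ} (hb : b ≠ 0) (hρ : (ρ - 1 / 2) ^ 2 = b⁻¹) (h₁ : s ≠ ρ)
    (h₂ : s ≠ 1 - ρ) (h₃ : s ≠ starRingEnd ℂ ρ) (h₄ : s ≠ 1 - starRingEnd ℂ ρ) :
    ((xiTerm b s + xiTerm (starRingEnd ℂ b) s) / 2).re =
      (lmPair s.re ρ.re (s.im - ρ.im) + lmPair s.re ρ.re (s.im + ρ.im)) / 2 := by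
  have hb' : starRingEnd ℂ b ≠ 0 := (map_ne_zero _).2 hb
  have hρ' : (starRingEnd ℂ ρ - 1 / 2) ^ 2 = (starRingEnd ℂ b)⁻¹ := by
    have := congrArg (starRingEnd ℂ) hρ
    simpa [map_ofNat] using this
  rw [xiTerm_eq_of_sq_eq hb hρ h₁ h₂, xiTerm_eq_of_sq_eq hb' hρ' h₃ h₄]
  simp only [Complex.div_ofNat_re, add_re, re_one_div_sub, sub_re, sub_im, one_re, one_im,
    Complex.conj_re, Complex.conj_im, lmPair]
  ring

end Literature.NumberTheory.LFunctions

end
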